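import Mathlib
import HarnessLib
import Summits.AtomisticToContinuum.BoseEinsteinCondensation.Theses.BECFeynmanVortexArea
import Literature.MathematicalPhysics.QuantumManyBody.BoseGasDirichletWall

/-!
# Route `BECFeynmanVortexArea`, support item `VortexAreaToPeriodicBEC` (stmt-AtomisticToContinuum-12608)

The route's glue: `VortexAreaFloor → TorusGroundState → GroundStateRepresentation → NearConvexity →
ZeroMomentumGround → MomentBoundCondensation → FreeGasCondensation →` the PeriodicBEC body (constant-mode
condensation of near-minimisers on the torus of side `(N/ρ)^{1/3}` at every small density) for every
BOUNDED repulsive finite-range pair potential `v`.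

Proof (bookkeeping over the route's declarations plus two elementary inequalities):

* `∫ v(|x|) dx < ∞` for bounded finite-range `v` (`lintegral_ne_top_of_bounded`); if `∫ v = 0` the
  conclusion is `FreeGasCondensation` verbatim.
* Otherwise `MomentBoundCondensation`, fed with `ZeroMomentumGround`, reduces the claim to the
  particle–hole floor `2E₀(N) + 2κ|k|² ≤ E_{N+1}(k) + E_{N-1}(k)` on the window `|k|² ≤ Cρ`,
  eventually in `N` at `L = (N/ρ)^{1/3}`.
* Sector floor (`sectorFloor`): for a Bloch-`k` state `Ψ` of `M = N ± 1` particles (density in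
  `[ρ/2, 2ρ]` for `N ≥ 2`) and the positive translation-invariant `C¹` ground state `Φ` of
  `TorusGroundState`, `F = Ψ/Φ` is `C¹`, periodic, symmetric, Bloch-`k`, `∫|F|²Φ² = 1`;
  `GroundStateRepresentation` gives `periodicEnergy Ψ = E₀(M) + ∫|∇F|²Φ²` and pointwise
  `|∇F|² ≥ 2 J_F` (AM–GM, `two_mul_jacobian_le_kineticDensity`); so either `∫|∇F|²Φ² > |k|²` or, by
  `VortexAreaFloor` with `Λ = 1`, `∫|∇F|²Φ² ≥ 2∫J_FΦ² ≥ 2c|k|²`: `E_M(k) ≥ E₀(M) + min(1,2c)|k|²`.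
* A non-empty Bloch-`k` class with `k ≠ 0` forces `(2π/L)² ≤ |k|²` (`bloch_lattice_bound`: shifting
  all particles by `L e_t` fixes the state, so `e^{i k_t L} = 1`); `NearConvexity` at tolerance
  `κ₁ = min(1,2c)` then gives the floor with `κ = κ₁/2`, no subtraction in `ℝ≥0∞`
  (`particleHole_of_sectorFloors`); an empty class contributes `⊤`.

References (context only — every analytic input is a hypothesis of the glue): Feynman, Phys. Rev. 94
(1954); Wagner, Z. Phys. 195 (1966); Stringari, PRB 52 (1995); Cornean–Dereziński–Ziń, JMP 50 (2009).
-/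

noncomputable section

open scoped BigOperators ENNReal NNReal
open Filter MeasureTheory

namespace Summit.AtomisticToContinuum.BoseEinsteinCondensation.Theorems

open Literature.MathematicalPhysics.QuantumManyBody.BoseGas
open Summit.AtomisticToContinuum.BoseEinsteinCondensation.Theses.BECFeynmanVortexArea

namespace VortexAreaToPeriodicBEC

/-- A bounded finite-range profile is integrable on `ℝ³`: `∫ v(|x|) dx ≤ M · |B̄(0,R₀)| < ∞`.
[folklore] -/
theorem lintegral_ne_top_of_bounded {v : ℝ → ℝ≥0∞} (hv : IsRepulsiveFiniteRange v)
    (hM : ∃ M : ℝ≥0, ∀ r, v r ≤ M) : (∫⁻ x : Space, v ‖x‖) ≠ ⊤ := by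
  obtain ⟨M, hle⟩ := hM
  obtain ⟨R₀, hR₀⟩ := hv.2
  have hbound : ∀ x : Space,
      v ‖x‖ ≤ (Metric.closedBall (0 : Space) R₀).indicator (fun _ => (M : ℝ≥0∞)) x := by
    intro x
    by_cases hx : x ∈ Metric.closedBall (0 : Space) R₀
    · rw [Set.indicator_of_mem hx]
      exact hle _
    · rw [Set.indicator_of_notMem hx, hR₀]
      rwa [Metric.mem_closedBall, dist_zero_right, not_le] at hx
  refine ne_top_of_le_ne_top ?_ (lintegral_mono hbound)
  rw [lintegral_indicator measurableSet_closedBall, setLIntegral_const]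
  exact ENNReal.mul_ne_top ENNReal.coe_ne_top measure_closedBall_lt_top.ne

/-- AM–GM on the Gram diagonal: `2√(ac - b²) ≤ a + c` for `a, c ≥ 0` (any real `b`). [folklore] -/
theorem two_mul_sqrt_gram_le {a b c : ℝ} (ha : 0 ≤ a) (hc : 0 ≤ c) :
    2 * Real.sqrt (a * c - b ^ 2) ≤ a + c := by
  have h1 : Real.sqrt (a * c - b ^ 2) ≤ Real.sqrt a * Real.sqrt c := by
    rw [← Real.sqrt_mul ha]
    exact Real.sqrt_le_sqrt (by nlinarith [sq_nonneg b])
  calc 2 * Real.sqrt (a * c - b ^ 2) ≤ 2 * (Real.sqrt a * Real.sqrt c) :=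
        mul_le_mul_of_nonneg_left h1 (by norm_num)
    _ = 2 * Real.sqrt a * Real.sqrt c := by ring
    _ ≤ Real.sqrt a ^ 2 + Real.sqrt c ^ 2 := two_mul_le_add_sq _ _
    _ = a + c := by rw [Real.sq_sqrt ha, Real.sq_sqrt hc]

/-- The 2-Jacobian of a family of complex numbers (area element of `d Re ∧ d Im` along the listed
directions) is at most half the sum of their squared moduli:
`2 ((Σ re²)(Σ im²) - (Σ re·im)²)^{1/2} ≤ Σ |·|²`. [folklore] -/
theorem two_mul_sqrt_gram_le_sum_norm_sq {M : ℕ} (D : Fin M → Fin 3 → ℂ) :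
    2 * Real.sqrt ((∑ i, ∑ t, (D i t).re ^ 2) * (∑ i, ∑ t, (D i t).im ^ 2) -
        (∑ i, ∑ t, (D i t).re * (D i t).im) ^ 2) ≤ ∑ i, ∑ t, ‖D i t‖ ^ 2 := by
  have hnorm : ∀ i t, ‖D i t‖ ^ 2 = (D i t).re ^ 2 + (D i t).im ^ 2 := fun i t => by
    rw [Complex.sq_norm, Complex.normSq_apply]; ring
  simp_rw [hnorm, Finset.sum_add_distrib]
  exact two_mul_sqrt_gram_le
    (Finset.sum_nonneg fun i _ => Finset.sum_nonneg fun t _ => sq_nonneg _)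
    (Finset.sum_nonneg fun i _ => Finset.sum_nonneg fun t _ => sq_nonneg _)

/-- The kinetic density as `ofReal` of a real sum of squared norms of partial derivatives.
[folklore] -/
theorem kineticDensity_eq_ofReal {M : ℕ} (F : Config M → ℂ) (X : Config M) :
    kineticDensity F X = ENNReal.ofReal
      (∑ i, ∑ t, ‖fderiv ℝ F X (Pi.single i (EuclideanSpace.single t (1 : ℝ)))‖ ^ 2) := by
  unfold kineticDensity
  rw [ENNReal.ofReal_sum_of_nonneg (fun i _ => Finset.sum_nonneg fun t _ => sq_nonneg _)]
  refine Finset.sum_congr rfl fun i _ => ?_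
  rw [ENNReal.ofReal_sum_of_nonneg (fun t _ => sq_nonneg _)]
  refine Finset.sum_congr rfl fun t _ => ?_
  rw [ENNReal.ofReal_pow (norm_nonneg _), ofReal_norm]
  rfl

/-- **Pointwise `|∇F|² ≥ 2 J_F`.** The kinetic density of `F` dominates twice its 2-Jacobian
`J_F = ((Σ(Re ∂F)²)(Σ(Im ∂F)²) - (Σ Re ∂F · Im ∂F)²)^{1/2}` (AM–GM on the Gram matrix of
`(∇ Re F, ∇ Im F)`: `J_F ≤ |∇Re F| |∇Im F| ≤ ½(|∇Re F|² + |∇Im F|²)`). [folklore] -/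
theorem two_mul_jacobian_le_kineticDensity {M : ℕ} (F : Config M → ℂ) (X : Config M) :
    2 * ENNReal.ofReal (Real.sqrt
      ((∑ i, ∑ t, (fderiv ℝ F X (Pi.single i (EuclideanSpace.single t (1 : ℝ)))).re ^ 2) *
        (∑ i, ∑ t, (fderiv ℝ F X (Pi.single i (EuclideanSpace.single t (1 : ℝ)))).im ^ 2) -
      (∑ i, ∑ t, (fderiv ℝ F X (Pi.single i (EuclideanSpace.single t (1 : ℝ)))).re *
        (fderiv ℝ F X (Pi.single i (EuclideanSpace.single t (1 : ℝ)))).im) ^ 2)) ≤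
    kineticDensity F X := by
  rw [kineticDensity_eq_ofReal]
  refine le_of_eq_of_le ?_ (ENNReal.ofReal_le_ofReal (two_mul_sqrt_gram_le_sum_norm_sq
    fun i t => fderiv ℝ F X (Pi.single i (EuclideanSpace.single t (1 : ℝ)))))
  rw [ENNReal.ofReal_mul (by norm_num : (0 : ℝ) ≤ 2), ENNReal.ofReal_ofNat]

/-- Periodicity in every particle at once: `Ψ(x₁ + L e_t, …, x_M + L e_t) = Ψ(x₁, …, x_M)` for a
periodic trial state (iterate the one-particle periodicity over the particles). [folklore] -/
theorem psi_add_const_single {M : ℕ} {L : ℝ} (Ψ : PeriodicTrialState M L) (t : Fin 3)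
    (X : Config M) : Ψ.ψ (fun i => X i + EuclideanSpace.single t L) = Ψ.ψ X := by
  have key : ∀ s : Finset (Fin M),
      Ψ.ψ (X + ∑ i ∈ s, Pi.single i (EuclideanSpace.single t L)) = Ψ.ψ X := by
    intro s
    induction s using Finset.induction_on with
    | empty => simp
    | insert a s ha ih =>
      have hX : X + ∑ i ∈ insert a s, Pi.single i (EuclideanSpace.single t L) =
          (X + ∑ i ∈ s, Pi.single i (EuclideanSpace.single t L)) +
            Pi.single a (EuclideanSpace.single t L) := by
        rw [Finset.sum_insert ha]; abel
      rw [hX, Ψ.periodic, ih]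
  have h := key Finset.univ
  rw [Finset.univ_sum_single fun _ : Fin M => EuclideanSpace.single t L] at h
  exact h

/-- **Non-empty Bloch classes live on the dual lattice.** If a (normalised, periodic) trial state
on the torus of side `L > 0` is Bloch-equivariant with momentum `k ≠ 0`, then `(2π/L)² ≤ |k|²`:
shifting every particle by `L e_t` is the identity on the state, so `e^{i k_t L} = 1`, i.e.
`k_t ∈ (2π/L)ℤ`, and some `k_t ≠ 0`. [folklore] -/
theorem bloch_lattice_bound {M : ℕ} {L : ℝ} (hL : 0 < L) (Ψ : PeriodicTrialState M L) {k : Space}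
    (hk : k ≠ 0)
    (hΨ : ∀ (s : Space) (X : Config M),
      Ψ.ψ (fun i => X i + s) = Complex.exp (Complex.I * ↑(∑ j, k j * s j)) * Ψ.ψ X) :
    (2 * Real.pi / L) ^ 2 ≤ ‖k‖ ^ 2 := by
  -- a point where `Ψ ≠ 0` (normalisation)
  obtain ⟨X₀, hX₀⟩ : ∃ X, Ψ.ψ X ≠ 0 := by
    by_contra h
    have h' : ∀ X, Ψ.ψ X = 0 := fun X => not_not.mp (not_exists.mp h X)
    have h1 := Ψ.norm_eq
    simp [h'] at h1
  -- a non-zero component of `k`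
  obtain ⟨t, ht⟩ : ∃ t, k t ≠ 0 := by
    by_contra h
    have h' : ∀ t, k t = 0 := fun t => not_not.mp (not_exists.mp h t)
    exact hk (PiLp.ext fun t => by simp [h' t])
  -- `exp (i k_t L) = 1`
  have hexp : Complex.exp (Complex.I * ↑(k t * L)) = 1 := by
    have h1 := hΨ (EuclideanSpace.single t L) X₀
    rw [psi_add_const_single] at h1
    have hsum : ∑ j, k j * (EuclideanSpace.single t L) j = k t * L := by
      simp [PiLp.single_apply]
    rw [hsum] at h1
    exact (mul_eq_right₀ hX₀).1 h1.symm
  obtain ⟨n, hn⟩ := Complex.exp_eq_one_iff.1 hexp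
  have hreal : k t * L = (n : ℝ) * (2 * Real.pi) := by
    have h2 : Complex.I * ↑(k t * L) = Complex.I * ↑((n : ℝ) * (2 * Real.pi)) := by
      rw [hn]; push_cast; ring
    exact_mod_cast mul_left_cancel₀ Complex.I_ne_zero h2
  have hn0 : n ≠ 0 := by
    rintro rfl
    simp only [Int.cast_zero, zero_mul, mul_eq_zero] at hreal
    rcases hreal with h | h; exacts [ht h, hL.ne' h]
  have h1n : (1 : ℝ) ≤ |(n : ℝ)| := by exact_mod_cast Int.one_le_abs hn0
  have hkt : 2 * Real.pi / L ≤ |k t| := by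
    rw [div_le_iff₀ hL]
    have h3 : |k t| * L = |(n : ℝ)| * (2 * Real.pi) := by
      rw [← abs_of_pos hL, ← abs_mul, hreal, abs_mul,
        abs_of_pos (by positivity : (0 : ℝ) < 2 * Real.pi)]
    rw [h3]
    nlinarith [Real.pi_pos]
  calc (2 * Real.pi / L) ^ 2 ≤ |k t| ^ 2 := by gcongr
    _ = (k t) ^ 2 := sq_abs _
    _ ≤ ‖k‖ ^ 2 := by
      rw [EuclideanSpace.real_norm_sq_eq]
      exact Finset.single_le_sum (fun i _ => sq_nonneg (k i)) (Finset.mem_univ t)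

/-- **One-sided sector floor `E_M(k) ≥ E₀(M) + min(1, 2c)|k|²`.** Let `Φ` be a strictly positive
real, translation-invariant periodic trial state of `M` bosons for which the ground-state
representation `∫(|∇(FΦ)|² + V|FΦ|²) = E₀·∫|F|²Φ² + ∫|∇F|²Φ²` holds for all `C¹` periodic symmetric
`F` (`hGR`), and suppose the vortex-area floor at `Λ = 1` holds at momentum `k` (`hVA`: every `C¹`
periodic symmetric Bloch-`k` map `F` with `∫|F|²Φ² = 1` and `∫|∇F|²Φ² ≤ |k|²` has `∫J_F Φ² ≥ c|k|²`).
Then every Bloch-`k` trial state `Ψ` has `periodicEnergy Ψ ≥ E₀(M) + min(1,2c)|k|²`: with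
`F = Ψ/Φ`, `periodicEnergy Ψ = E₀ + ∫|∇F|²Φ²` and either `∫|∇F|²Φ² > |k|²` or
`∫|∇F|²Φ² ≥ 2∫J_FΦ² ≥ 2c|k|²` by `|∇F|² ≥ 2J_F`. [folklore] -/
theorem sectorFloor {v : ℝ → ℝ≥0∞} {M : ℕ} {L c : ℝ} {k : Space} (Φ : PeriodicTrialState M L)
    (hΦpos : ∀ X, 0 < (Φ.ψ X).re ∧ (Φ.ψ X).im = 0)
    (hΦtr : ∀ (s : Space) (X : Config M), Φ.ψ (fun i => X i + s) = Φ.ψ X)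
    (hGR : ∀ F : Config M → ℂ, ContDiff ℝ 1 F →
      (∀ (X : Config M) (i : Fin M) (t : Fin 3),
        F (X + Pi.single i (EuclideanSpace.single t L)) = F X) →
      (∀ (σ : Equiv.Perm (Fin M)) (X : Config M), F (X ∘ σ) = F X) →
      ∫⁻ X in cellN M L, kineticDensity (fun Y => F Y * Φ.ψ Y) X +
          periodicInteraction v L X * (‖F X * Φ.ψ X‖₊ : ℝ≥0∞) ^ 2 =
        periodicGroundStateEnergy v M L *
            (∫⁻ X in cellN M L, (‖F X‖₊ : ℝ≥0∞) ^ 2 * (‖Φ.ψ X‖₊ : ℝ≥0∞) ^ 2) +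
          ∫⁻ X in cellN M L, kineticDensity F X * (‖Φ.ψ X‖₊ : ℝ≥0∞) ^ 2)
    (hVA : ∀ F : Config M → ℂ, ContDiff ℝ 1 F →
      (∀ (X : Config M) (i : Fin M) (t : Fin 3),
        F (X + Pi.single i (EuclideanSpace.single t L)) = F X) →
      (∀ (σ : Equiv.Perm (Fin M)) (X : Config M), F (X ∘ σ) = F X) →
      (∀ (s : Space) (X : Config M),
        F (fun i => X i + s) = Complex.exp (Complex.I * ↑(∑ j, k j * s j)) * F X) →
      ∫⁻ X in cellN M L, (‖F X‖₊ : ℝ≥0∞) ^ 2 * (‖Φ.ψ X‖₊ : ℝ≥0∞) ^ 2 = 1 →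
      ∫⁻ X in cellN M L, kineticDensity F X * (‖Φ.ψ X‖₊ : ℝ≥0∞) ^ 2 ≤
        ENNReal.ofReal (1 * ‖k‖ ^ 2) →
      ENNReal.ofReal (c * ‖k‖ ^ 2) ≤ ∫⁻ X in cellN M L, ENNReal.ofReal (Real.sqrt
        ((∑ i, ∑ t, (fderiv ℝ F X (Pi.single i (EuclideanSpace.single t (1 : ℝ)))).re ^ 2) *
          (∑ i, ∑ t, (fderiv ℝ F X (Pi.single i (EuclideanSpace.single t (1 : ℝ)))).im ^ 2) -
        (∑ i, ∑ t, (fderiv ℝ F X (Pi.single i (EuclideanSpace.single t (1 : ℝ)))).re *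
          (fderiv ℝ F X (Pi.single i (EuclideanSpace.single t (1 : ℝ)))).im) ^ 2)) *
        (‖Φ.ψ X‖₊ : ℝ≥0∞) ^ 2)
    (Ψ : PeriodicTrialState M L)
    (hΨ : ∀ (s : Space) (X : Config M),
      Ψ.ψ (fun i => X i + s) = Complex.exp (Complex.I * ↑(∑ j, k j * s j)) * Ψ.ψ X) :
    periodicGroundStateEnergy v M L + ENNReal.ofReal (min 1 (2 * c) * ‖k‖ ^ 2) ≤
      periodicEnergy v Ψ := by
  have hΦne : ∀ X, Φ.ψ X ≠ 0 := fun X h => (hΦpos X).1.ne' (by rw [h]; rfl)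
  -- the quotient `F = Ψ / Φ`
  obtain ⟨F, hF⟩ : ∃ F : Config M → ℂ, F = fun X => Ψ.ψ X / Φ.ψ X := ⟨_, rfl⟩
  have hFΦ : ∀ X, F X * Φ.ψ X = Ψ.ψ X := fun X => by
    rw [hF]; exact div_mul_cancel₀ _ (hΦne X)
  have hFcd : ContDiff ℝ 1 F := by
    rw [hF]; simp only [div_eq_mul_inv]
    exact Ψ.contDiff.mul (Φ.contDiff.inv hΦne)
  have hFper : ∀ (X : Config M) (i : Fin M) (t : Fin 3),
      F (X + Pi.single i (EuclideanSpace.single t L)) = F X := by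
    intro X i t; simp only [hF, Ψ.periodic, Φ.periodic]
  have hFsymm : ∀ (σ : Equiv.Perm (Fin M)) (X : Config M), F (X ∘ σ) = F X := by
    intro σ X; simp only [hF, Ψ.symm, Φ.symm]
  have hFbloch : ∀ (s : Space) (X : Config M),
      F (fun i => X i + s) = Complex.exp (Complex.I * ↑(∑ j, k j * s j)) * F X := by
    intro s X; simp only [hF, hΨ s X, hΦtr s X, mul_div_assoc]
  have hnormF : ∀ X, (‖F X‖₊ : ℝ≥0∞) ^ 2 * (‖Φ.ψ X‖₊ : ℝ≥0∞) ^ 2 = (‖Ψ.ψ X‖₊ : ℝ≥0∞) ^ 2 := by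
    intro X; rw [← mul_pow, ← ENNReal.coe_mul, ← nnnorm_mul, hFΦ]
  have hnorm1 : ∫⁻ X in cellN M L, (‖F X‖₊ : ℝ≥0∞) ^ 2 * (‖Φ.ψ X‖₊ : ℝ≥0∞) ^ 2 = 1 := by
    simp_rw [hnormF]; exact Ψ.norm_eq
  -- ground-state representation: `periodicEnergy Ψ = E₀ + ∫ |∇F|²Φ²`
  have hrep : periodicEnergy v Ψ = periodicGroundStateEnergy v M L +
      ∫⁻ X in cellN M L, kineticDensity F X * (‖Φ.ψ X‖₊ : ℝ≥0∞) ^ 2 := by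
    have h := hGR F hFcd hFper hFsymm
    rw [hnorm1, mul_one] at h
    have hfun : (fun Y => F Y * Φ.ψ Y) = Ψ.ψ := funext hFΦ
    rw [hfun] at h
    simp_rw [hFΦ] at h
    exact h
  -- the dichotomy `∫|∇F|²Φ² > |k|²` or (vortex-area floor) `∫|∇F|²Φ² ≥ 2∫J_FΦ² ≥ 2c|k|²`
  have hk2 : ENNReal.ofReal (min 1 (2 * c) * ‖k‖ ^ 2) ≤
      ∫⁻ X in cellN M L, kineticDensity F X * (‖Φ.ψ X‖₊ : ℝ≥0∞) ^ 2 := by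
    by_cases hcase : ∫⁻ X in cellN M L, kineticDensity F X * (‖Φ.ψ X‖₊ : ℝ≥0∞) ^ 2 ≤
        ENNReal.ofReal (1 * ‖k‖ ^ 2)
    · have hcVA := hVA F hFcd hFper hFsymm hFbloch hnorm1 hcase
      calc ENNReal.ofReal (min 1 (2 * c) * ‖k‖ ^ 2)
          ≤ ENNReal.ofReal (2 * (c * ‖k‖ ^ 2)) := by
            refine ENNReal.ofReal_le_ofReal ?_
            rw [← mul_assoc]
            exact mul_le_mul_of_nonneg_right (min_le_right _ _) (sq_nonneg _)
        _ = 2 * ENNReal.ofReal (c * ‖k‖ ^ 2) := by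
            rw [ENNReal.ofReal_mul (by norm_num : (0 : ℝ) ≤ 2), ENNReal.ofReal_ofNat]
        _ ≤ _ := mul_le_mul_of_nonneg_left hcVA zero_le
        _ ≤ _ := (lintegral_const_mul_le 2 _).trans (lintegral_mono fun X => by
            rw [← mul_assoc]
            exact mul_le_mul_of_nonneg_right (two_mul_jacobian_le_kineticDensity F X) zero_le)
    · calc ENNReal.ofReal (min 1 (2 * c) * ‖k‖ ^ 2) ≤ ENNReal.ofReal (1 * ‖k‖ ^ 2) :=
            ENNReal.ofReal_le_ofReal
              (mul_le_mul_of_nonneg_right (min_le_left _ _) (sq_nonneg _))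
        _ ≤ _ := (not_le.mp hcase).le
  rw [hrep]
  exact add_le_add le_rfl hk2

/-- **Particle–hole floor from the two one-sided sector floors and near-convexity**, at fixed
`(N, L, k)`, with no subtraction in `ℝ≥0∞`: if `2E₀(N) ≤ E₀(N+1) + E₀(N-1) + κ₁(2π/L)²`, every
Bloch-`k` state of `N ± 1` particles has energy `≥ E₀(N±1) + κ₁|k|²`, and a non-empty Bloch-`k` class
of `N + 1` particles forces `(2π/L)² ≤ |k|²`, then `2E₀(N) + 2(κ₁/2)|k|² ≤ E_{N+1}(k) + E_{N-1}(k)`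
(an empty class makes the right-hand side `⊤`). [folklore] -/
theorem particleHole_of_sectorFloors {v : ℝ → ℝ≥0∞} {N : ℕ} {L κ₁ : ℝ} {k : Space} (hκ₁ : 0 ≤ κ₁)
    (hNC : 2 * periodicGroundStateEnergy v N L ≤ periodicGroundStateEnergy v (N + 1) L +
      periodicGroundStateEnergy v (N - 1) L + ENNReal.ofReal (κ₁ * (2 * Real.pi / L) ^ 2))
    (hplus : ∀ Ψ : PeriodicTrialState (N + 1) L, (∀ (s : Space) (X : Config (N + 1)),
        Ψ.ψ (fun i => X i + s) = Complex.exp (Complex.I * ↑(∑ j, k j * s j)) * Ψ.ψ X) →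
      periodicGroundStateEnergy v (N + 1) L + ENNReal.ofReal (κ₁ * ‖k‖ ^ 2) ≤ periodicEnergy v Ψ)
    (hminus : ∀ Ψ : PeriodicTrialState (N - 1) L, (∀ (s : Space) (X : Config (N - 1)),
        Ψ.ψ (fun i => X i + s) = Complex.exp (Complex.I * ↑(∑ j, k j * s j)) * Ψ.ψ X) →
      periodicGroundStateEnergy v (N - 1) L + ENNReal.ofReal (κ₁ * ‖k‖ ^ 2) ≤ periodicEnergy v Ψ)
    (hlat : ∀ Ψ : PeriodicTrialState (N + 1) L, (∀ (s : Space) (X : Config (N + 1)),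
        Ψ.ψ (fun i => X i + s) = Complex.exp (Complex.I * ↑(∑ j, k j * s j)) * Ψ.ψ X) →
      (2 * Real.pi / L) ^ 2 ≤ ‖k‖ ^ 2) :
    2 * periodicGroundStateEnergy v N L + ENNReal.ofReal (2 * (κ₁ / 2) * ‖k‖ ^ 2) ≤
      (⨅ (Ψ : PeriodicTrialState (N + 1) L) (_ : ∀ (s : Space) (X : Config (N + 1)),
          Ψ.ψ (fun i => X i + s) = Complex.exp (Complex.I * ↑(∑ j, k j * s j)) * Ψ.ψ X),
        periodicEnergy v Ψ) +
      (⨅ (Ψ : PeriodicTrialState (N - 1) L) (_ : ∀ (s : Space) (X : Config (N - 1)),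
          Ψ.ψ (fun i => X i + s) = Complex.exp (Complex.I * ↑(∑ j, k j * s j)) * Ψ.ψ X),
        periodicEnergy v Ψ) := by
  by_cases hne : ∃ Ψ : PeriodicTrialState (N + 1) L, ∀ (s : Space) (X : Config (N + 1)),
      Ψ.ψ (fun i => X i + s) = Complex.exp (Complex.I * ↑(∑ j, k j * s j)) * Ψ.ψ X
  · obtain ⟨Ψ₀, hΨ₀⟩ := hne
    have hkL := hlat Ψ₀ hΨ₀
    have h1 : ENNReal.ofReal (κ₁ * (2 * Real.pi / L) ^ 2) ≤ ENNReal.ofReal (κ₁ * ‖k‖ ^ 2) :=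
      ENNReal.ofReal_le_ofReal (mul_le_mul_of_nonneg_left hkL hκ₁)
    have h2 : ENNReal.ofReal (2 * (κ₁ / 2) * ‖k‖ ^ 2) = ENNReal.ofReal (κ₁ * ‖k‖ ^ 2) := by
      congr 1; ring
    calc 2 * periodicGroundStateEnergy v N L + ENNReal.ofReal (2 * (κ₁ / 2) * ‖k‖ ^ 2)
        ≤ (periodicGroundStateEnergy v (N + 1) L + periodicGroundStateEnergy v (N - 1) L +
            ENNReal.ofReal (κ₁ * (2 * Real.pi / L) ^ 2)) + ENNReal.ofReal (κ₁ * ‖k‖ ^ 2) := by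
          rw [h2]; exact add_le_add hNC le_rfl
      _ ≤ (periodicGroundStateEnergy v (N + 1) L + periodicGroundStateEnergy v (N - 1) L +
            ENNReal.ofReal (κ₁ * ‖k‖ ^ 2)) + ENNReal.ofReal (κ₁ * ‖k‖ ^ 2) :=
          add_le_add (add_le_add le_rfl h1) le_rfl
      _ = (periodicGroundStateEnergy v (N + 1) L + ENNReal.ofReal (κ₁ * ‖k‖ ^ 2)) +
            (periodicGroundStateEnergy v (N - 1) L + ENNReal.ofReal (κ₁ * ‖k‖ ^ 2)) := by ring
      _ ≤ _ := add_le_add (le_iInf₂ hplus) (le_iInf₂ hminus)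
  · have htop : (⨅ (Ψ : PeriodicTrialState (N + 1) L) (_ : ∀ (s : Space) (X : Config (N + 1)),
        Ψ.ψ (fun i => X i + s) = Complex.exp (Complex.I * ↑(∑ j, k j * s j)) * Ψ.ψ X),
        periodicEnergy v Ψ) = ⊤ :=
      iInf_eq_top.2 fun Ψ => iInf_neg fun h => hne ⟨Ψ, h⟩
    rw [htop, top_add]
    exact le_top

/-- The density window `[ρ/2, 2ρ]` at side `L` with `N/L³ = ρ`, for any particle number `x` with
`N ≤ 2x ≤ 4N` (used for `x = N ± 1`, `N ≥ 2`). [folklore] -/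
theorem density_window {ρ L x : ℝ} {N : ℕ} (hL3 : 0 < L ^ 3) (hdens : (N : ℝ) / L ^ 3 = ρ)
    (hx1 : (N : ℝ) ≤ 2 * x) (hx2 : x ≤ 2 * N) : ρ / 2 ≤ x / L ^ 3 ∧ x / L ^ 3 ≤ 2 * ρ := by
  rw [div_eq_iff hL3.ne'] at hdens
  constructor
  · rw [le_div_iff₀ hL3]; linarith
  · rw [div_le_iff₀ hL3]; linarith

end VortexAreaToPeriodicBEC

open VortexAreaToPeriodicBEC in
/-- **`VortexAreaToPeriodicBEC` holds** (settles stmt-AtomisticToContinuum-12608, exact route decl):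
`VortexAreaFloor → TorusGroundState → GroundStateRepresentation → NearConvexity → ZeroMomentumGround →
MomentBoundCondensation → FreeGasCondensation →` for every bounded repulsive finite-range `v`, the
PeriodicBEC body for `v`: `∫v < ∞`; `∫v = 0` is `FreeGasCondensation`; otherwise
`MomentBoundCondensation` with `ZeroMomentumGround` and the particle–hole floor assembled from the
sector floors of `N ± 1` particles (`sectorFloor`: `VortexAreaFloor` at `Λ = 1`, `TorusGroundState`,
`GroundStateRepresentation`), `bloch_lattice_bound` and `NearConvexity` at `min(1, 2c)`. [folklore] -/
theorem vortexAreaToPeriodicBEC_proof :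
    Summit.AtomisticToContinuum.BoseEinsteinCondensation.Theses.BECFeynmanVortexArea.VortexAreaToPeriodicBEC := by
  unfold VortexAreaToPeriodicBEC
  intro hVA hGS hGR hNC hZM hMB hFG v hv hvM
  have hint : (∫⁻ x : Space, v ‖x‖) ≠ ⊤ := lintegral_ne_top_of_bounded hv hvM
  by_cases h0 : (∫⁻ x : Space, v ‖x‖) = 0
  · exact hFG v hv h0
  refine hMB v hv hint h0 (hZM v hv hint) ?_
  -- the particle–hole floor on the window `|k|² ≤ Cρ`
  intro C hC
  obtain ⟨c, hc, ρ₁, hρ₁, H1⟩ := hVA v hv hvM h0 C hC 1 one_pos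
  have hκ₁ : 0 < min 1 (2 * c) := lt_min one_pos (by positivity)
  obtain ⟨ρ₂, hρ₂, H2⟩ := hNC v hv hvM (min 1 (2 * c)) hκ₁
  refine ⟨min 1 (2 * c) / 2, by positivity, min ρ₁ ρ₂, lt_min hρ₁ hρ₂, fun ρ hρ hρlt => ?_⟩
  have hρ1 : ρ < ρ₁ := hρlt.trans_le (min_le_left _ _)
  have hρ2 : ρ < ρ₂ := hρlt.trans_le (min_le_right _ _)
  filter_upwards [(tendsto_sideLength_atTop hρ).eventually (H1 ρ hρ hρ1), H2 ρ hρ hρ2,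
    eventually_ge_atTop 2] with N hP hN2c hN2
  intro k hk hkC
  have hN0 : 0 < N := by omega
  have hL : 0 < sideLength ρ N := sideLength_pos_of_pos hρ hN0
  have hL3 : 0 < sideLength ρ N ^ 3 := by positivity
  have hdens : (N : ℝ) / sideLength ρ N ^ 3 = ρ := div_sideLength_pow_three hρ hN0
  have hN2r : (2 : ℝ) ≤ N := by exact_mod_cast hN2
  -- densities of `N ± 1` particles lie in the window `[ρ/2, 2ρ]`
  have hwp : ρ / 2 ≤ ((N + 1 : ℕ) : ℝ) / sideLength ρ N ^ 3 ∧
      ((N + 1 : ℕ) : ℝ) / sideLength ρ N ^ 3 ≤ 2 * ρ :=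
    density_window hL3 hdens (by push_cast; linarith) (by push_cast; linarith)
  have hwm : ρ / 2 ≤ ((N - 1 : ℕ) : ℝ) / sideLength ρ N ^ 3 ∧
      ((N - 1 : ℕ) : ℝ) / sideLength ρ N ^ 3 ≤ 2 * ρ := by
    have hcast : ((N - 1 : ℕ) : ℝ) = (N : ℝ) - 1 := by
      rw [Nat.cast_sub (by omega : 1 ≤ N), Nat.cast_one]
    refine density_window hL3 hdens ?_ ?_ <;> rw [hcast] <;> linarith
  -- one-sided sector floors for `M = N ± 1`
  have key : ∀ M : ℕ, ρ / 2 ≤ (M : ℝ) / sideLength ρ N ^ 3 →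
      (M : ℝ) / sideLength ρ N ^ 3 ≤ 2 * ρ →
      ∀ Ψ : PeriodicTrialState M (sideLength ρ N), (∀ (s : Space) (X : Config M),
        Ψ.ψ (fun i => X i + s) = Complex.exp (Complex.I * ↑(∑ j, k j * s j)) * Ψ.ψ X) →
      periodicGroundStateEnergy v M (sideLength ρ N) + ENNReal.ofReal (min 1 (2 * c) * ‖k‖ ^ 2) ≤
        periodicEnergy v Ψ := by
    intro M hM1 hM2 Ψ hΨ
    obtain ⟨Φ, hΦE, hΦtop, hΦpos, hΦtr⟩ := hGS v hv hvM M (sideLength ρ N) hL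
    exact sectorFloor Φ hΦpos hΦtr (hGR v hv hvM M (sideLength ρ N) Φ hΦE hΦtop hΦpos)
      (hP M hM1 hM2 Φ hΦE hΦtop hΦpos hΦtr k hk hkC) Ψ hΨ
  exact particleHole_of_sectorFloors hκ₁.le hN2c (key (N + 1) hwp.1 hwp.2)
    (key (N - 1) hwm.1 hwm.2) (fun Ψ hΨ => bloch_lattice_bound hL Ψ hk hΨ)

end Summit.AtomisticToContinuum.BoseEinsteinCondensation.Theorems

end
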